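import Summits.QuantumFields.YangMills.Theorems.BalabanUVNodesK0Stub1SectFWSlotAtRecord
import Summits.QuantumFields.YangMills.Theorems.BalabanUVNodesK0Stub1MultiplierO1LetterAtRecord
import HarnessLib

/-!
# K0⁷ STUB 1 (`stub_prop8StepCoP13`), sub-target S4b «the (δ∕δA′)V pieces at objects» — THE W-SLOT OF SECT. F's `W` AT THE RECORD, `O₁` DISCHARGED:
# **the S4b capstone `K0Stub1SectFWSlotAtRecord.exists_sectF_W_atRecord_of_numericLetters_anyQ` (p612123) AT EVERY ADMISSIBLE FAMILY OF THE RECORD's FOUR-TORI WITH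
# THE MULTIPLIER OF RECORD `η^d•M_V` AND ITS (3.132) LETTER `O₁` SUPPLIED BY k0-s1-w4's `K0Stub1MultiplierO1LetterAtRecord.h3132_of_adm22_T4` (p616957)** — displayed
# after this file: the output block weight `wB′` IN THE MULTIPLIER BAND `0 ≤ wB′(t) ≤ (L^{j(t)}η)⁻¹` and THREE numbers `q₀ θ₀ h₀` (+ the averaging letter `q` of the
# free average `Q` of the multiplier term), with ONE constant `O₁ = O₁(L)` inside `C₄`

Cell `pub-ymgap`, width seat `pub-ymgap-k0-s1-w2` g4 (CLAIM-1; HOME `pub-ymgap-k0-s1-w2/HANDOFF.md` § g3 trigger (t1′)).  `--kind proof --supports stmt-QuantumFields-20541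
--as helper`; count-neutral.  [15] = [Balaban1985Variational]; [B6] = [Balaban1984PropagatorsII].

WHY.  p612123 displays FOUR numbers `O₁ q₀ θ₀ h₀` (+`q`) together with a free output block weight `wB′`; k0-s1-w4's FILE 4 proves the first — the (3.132)-shaped sup letter
of the normalised multiplier `η^d•M_V` ([B6] Prop. 2.7 (2.149) + Lemma 2.1 through the port pads) — for EVERY `wB′` in the band `wB′(t)·(L^{j(t)}η) ≤ 1`, at every admissible
family of the record's tori in the standing range, for `M_V` given by p598821's kernel formula at ANY auxiliary weights.  THIS FILE is the junction: the capstone in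
`T4Family` currency with that letter consumed by name — thresholds `Mh₀`, `R₀ := max R₀ (2L)` (the capstone's `2L ≤ R′`), `M := L·M_h ≥ 1`, `d = 4` by `rfl`,
`B`-symmetry of `η^d•M_V` by `smul_multiplier_symm`.

WHAT IS PROVED (sorry-free; no definition; axioms standard).
* ★★★ `exists_sectF_W_atRecord_O1_anyQ` — for every `F : T4Family`, `N ≥ 1`: `∃ Mh₀ R₀ O₁ ≥ 0` such that at every admissible nested family `D` on `Site (F.P K) 0` of top level
  `K − n` in the standing range (`1 ≤ K − n`, `K − n + 1 ≤ m + K`, `M_h = L^{a′} ≥ Mh₀`, `R ≥ R₀`, `a′ + 3 ≤ m + n`, `Adm22 D R (L·M_h)`), for the level weights, every right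
  inverse `H` of the true linearisation with both (46) rows, the `ε`-window, the fibre letters, the pairings (27)∕block-trace, EVERY `M_V` with p598821's kernel formula
  (`c = L^{K−n}`, any auxiliary weights) and ANY average `Q`: p612123's conclusion VERBATIM at `MV := η^d•M_V` with the `h3132` binder and the `0 ≤ O₁` binder GONE —
  displayed: `wB′` in the band, `q₀ θ₀ h₀ ℓ q` and their four letters; `C₄ = θ₀O₁(4C₂ε + q) + q₀O₁·4C₂ + (1 + θ₀εh₀)(d−1)L⁶M_ρ(200 + 2L²)ℓ²` with the file's `O₁`.
HONEST SCOPE ∕ WHAT THIS IS NOT.  (1) Composition by name (p612123 ∘ k0-s1-w4's FILE 4); NO estimate proved here.  (2) LOCATED-BASEPOINT (this seat, bus 2026-08-28 08:28Z,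
certified half `K0Stub1QlinTransposeBasePoint`): with the SINGLE-bar chart `chartLog` the letters `q₀` (if `Q := Qlin`) and `θ₀` are NOT k-uniformly inhabitable (base-point
modes); this junction is chart-of-record bookkeeping and inherits that caveat — it does not claim the three remaining numbers exist uniformly.  (3) Whether `V` with
(`Q`, `H`, `η^d•M_V`) IS Sect. F's functional at the record is road R0′'s (87)∕(128) junction — NOT asserted.  (4) `stub_prop8StepCoP13` ∕ K0⁷ NOT closed; N07 NOT discharged;
counts unmoved (28∕28 · 5∕27); one finite 𝕋⁴ programme at fixed ε — R4 closes the conditional finite-𝕋⁴ rung `BalabanLadder.UV` only, never the summit; the YM mass gap (Clay)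
is NOT proved by any of this; nothing continuum ∕ ℝ⁴ ∕ OS.  No `sorry`, no `def`, no `instance`, no `notation`.

References: [15] (27) p.282, (45)–(50) p.285, (55)–(58) pp.286–287, (63)–(73) pp.287–289, (87)–(90) p.291, Prop. 4 (97)–(98) pp.292–293, (157)–(158) p.302; [B6] (2.2) p.224,
(2.35) p.228, Prop. 2.7 (2.149) p.249, Lemma 2.1 (2.59)–(2.61) pp.233–234, Cor. 2.8 p.249.
-/

set_option autoImplicit false

noncomputable section

open scoped BigOperators Matrix.Norms.L2Operator Topology ContDiff
open NormedSpace Metric Set Filter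

namespace Summit.QuantumFields.YangMills.Theorems.K0Stub1SectFWSlotAtRecordO1

open Literature.MathematicalPhysics.QuantumFieldTheory.Balaban1983to89
open Literature.MathematicalPhysics.QuantumFieldTheory.Balaban1983to89.T4Continuum (T4Family)
open Literature.MathematicalPhysics.QuantumFieldTheory.Balaban1983to89.B6SectADomainsV1 (Domains)
open Literature.MathematicalPhysics.QuantumFieldTheory.Balaban1983to89.B6SectAOperatorsV1 (BondIdx aE)
open Literature.MathematicalPhysics.QuantumFieldTheory.Balaban1983to89.B6SectAVectorModelV1 (EE)
open B4Sect5Torus (TSite)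
open B9Eq39Adjoint (bondPair)
open B11Eq26ActionExpansion (V0)
open Summit.QuantumFields.YangMills.Theorems.FlatCubeOpsText (Adm22)
open Summit.QuantumFields.YangMills.Theorems.K0FlatCubeOpsTextP (IsLevWeight)
open Summit.QuantumFields.YangMills.Theorems.Prop8Chart (chartLog)
open Summit.QuantumFields.YangMills.Theorems.K0Stub1SectFWSlotAtRecord (exists_sectF_W_atRecord_of_numericLetters_anyQ)
open Summit.QuantumFields.YangMills.Theorems.K0Stub1MultiplierO1LetterAtRecord (h3132_of_adm22_T4 smul_multiplier_symm)

/-- ★★★ **THE W-SLOT OF SECT. F's `W = (δ∕δA′)V` AT EVERY ADMISSIBLE FAMILY OF THE RECORD's FOUR-TORI, MULTIPLIER `η^d•M_V`, `O₁` DISCHARGED** (see the module docstring;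
binders = p612123's in `T4Family` currency + p598821's kernel formula for `M_V`; displayed: `wB′` in the multiplier band, the numbers `q₀ θ₀ h₀ ℓ q` with their letters).
[cite: Balaban1985Variational, Prop. 4 (97)-(98) pp.292-293, (157)-(158) p.302, (63) p.287, (87)-(90) p.291, (27) p.282, (45)-(50) p.285, (55)-(58) pp.286-287, (73) p.289; Balaban1984PropagatorsII, (2.2) p.224, Prop. 2.7 (2.149) p.249, Lemma 2.1 (2.61) p.234, Cor. 2.8 p.249] -/
theorem exists_sectF_W_atRecord_O1_anyQ (N : ℕ) [NeZero N] (F : T4Family) :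
    ∃ (Mh₀ R₀ : ℕ) (O₁ : ℝ), 0 ≤ O₁ ∧
    ∀ (n K : ℕ) (_ : 1 ≤ K - n) (_ : K - n + 1 ≤ F.m + K) {Mh R a' : ℕ} (_ : Mh = F.L ^ a') (_ : Mh₀ ≤ Mh) (_ : R₀ ≤ R)
      (_ : a' + 3 ≤ F.m + n) (D : Domains (F.P K)) (hDk : D.k = K - n) (_ : Adm22 D R (F.L * Mh))
      [Fact ((0 : ℝ) < ((F.P K).L : ℝ))] [Fact ((0 : ℝ) < (((F.P K).L : ℝ))⁻¹ ^ (K - n))]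
    {w : ℕ → PBond (F.P K) 0 → ℝ} (hw : IsLevWeight (F.P K) (K - n) D w)
    -- the right inverse `H` of the true linearisation with BOTH (46) rows (dag k0-s1-w1's p604736 gives the sup row; UST `ChartHInv.exists_rightInverse₂` the gradient row)
    (H : (BondIdx D → Matrix (Fin N) (Fin N) ℂ) →ₗ[ℂ] (PBond (F.P K) 0 → Matrix (Fin N) (Fin N) ℂ))
    (hHinv : ∀ X, (fderiv ℂ (chartLog ((((F.P K).L : ℝ)⁻¹) ^ (K - n)) D : (PBond (F.P K) 0 → Matrix (Fin N) (Fin N) ℂ) → BondIdx D → Matrix (Fin N) (Fin N) ℂ) 0) (H X) = X)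
    {B₀ : ℝ} (hB₀ : 0 ≤ B₀)
    (hHB : ∀ (X : BondIdx D → Matrix (Fin N) (Fin N) ℂ) (t : ℝ), 0 ≤ t → (∀ i, ‖X i‖ ≤ t) → ∀ b, w 1 b * ‖H X b‖ ≤ B₀ * t)
    {B₁ : ℝ} (hB₁ : 0 ≤ B₁)
    (hHgrad : ∀ (X : BondIdx D → Matrix (Fin N) (Fin N) ℂ) (t : ℝ), 0 ≤ t → (∀ i, ‖X i‖ ≤ t) →
      ∀ (b : PBond (F.P K) 0) (ν : Fin (F.P K).d), w 2 b * ((F.P K).L : ℝ) ^ (K - n) * ‖H X ⟨b.src.shift ν, b.dir⟩ - H X b‖ ≤ B₁ * t)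
    -- the `ε`-window of dag-n07-w2's `N07ChartDDerivative` for this `B₀`
    {ε : ℝ} (hε : 0 < ε) (h18 : 18 * (960 * ((((F.P K).d + 2) * (F.P K).L : ℕ) : ℝ) * ((F.P K).L : ℝ) / (12800 * ((((F.P K).d + 2) * (F.P K).L : ℕ) : ℝ) ^ 2 * ((F.P K).L : ℝ))⁻¹) * B₀ * ε ≤ 1)
    (h2 : 64 * ε ≤ (12800 * ((((F.P K).d + 2) * (F.P K).L : ℕ) : ℝ) ^ 2 * ((F.P K).L : ℝ))⁻¹)
    -- the fibre letters (g0's `K0Stub1FibreTraceLetters.exists_fibreLetters`: `τ = ntr`, dualiser `ρ`, `M_ρ = N³`)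
    (τ : Matrix (Fin N) (Fin N) ℂ →L[ℂ] ℂ) (ρ : (Matrix (Fin N) (Fin N) ℂ →L[ℂ] ℂ) →L[ℂ] Matrix (Fin N) (Fin N) ℂ)
    (hρ : ∀ (ℓ' : Matrix (Fin N) (Fin N) ℂ →L[ℂ] ℂ) (X : Matrix (Fin N) (Fin N) ℂ), τ (ρ ℓ' * X) = ℓ' X)
    (hτ : ∀ a b : Matrix (Fin N) (Fin N) ℂ, τ (a * b) = τ (b * a)) (hτs : ∀ a : Matrix (Fin N) (Fin N) ℂ, τ (star a) = starRingEnd ℂ (τ a))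
    (hτ1 : ∀ X : Matrix (Fin N) (Fin N) ℂ, ‖τ X‖ ≤ ‖X‖) {Mρ : ℝ} (hMρ : 0 ≤ Mρ) (hρn : ∀ ℓ' : Matrix (Fin N) (Fin N) ℂ →L[ℂ] ℂ, ‖ρ ℓ'‖ ≤ Mρ * ‖ℓ'‖)
    -- the pairings (27) ∕ (66) and a `B`-symmetric multiplier (p598821's `exists_pairings_transposes_flatOps`: `BE`, `B`, `M_V`)
    (BE : (PBond (F.P K) 0 → Matrix (Fin N) (Fin N) ℂ) →L[ℂ] (PBond (F.P K) 0 → Matrix (Fin N) (Fin N) ℂ) →L[ℂ] ℂ)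
    (hBE : ∀ Y δ : PBond (F.P K) 0 → Matrix (Fin N) (Fin N) ℂ, BE Y δ =
      bondPair ((((F.P K).L : ℝ))⁻¹ ^ (K - n)) (F.P K).d (τ : Matrix (Fin N) (Fin N) ℂ →ₗ[ℂ] ℂ) (fun μ x => Y ⟨x, μ⟩) (fun μ x => δ ⟨x, μ⟩))
    (B : (BondIdx D → Matrix (Fin N) (Fin N) ℂ) →L[ℂ] (BondIdx D → Matrix (Fin N) (Fin N) ℂ) →L[ℂ] ℂ)
    (hB : ∀ X X' : BondIdx D → Matrix (Fin N) (Fin N) ℂ, B X X' = ∑ t, τ (X t * X' t)) (hBsymm : ∀ a b, B a b = B b a)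
    -- the multiplier WITH p598821's kernel formula (`c = L^{K−n}`, ANY auxiliary weights `wa > 0`), `B`-symmetric; the capstone is fed `η^d • M_V` (k0-s1-w4's normalisation p612514)
    (hc : ((F.P K).L : ℝ) ^ (K - n) ≠ 0) {wa : BondIdx D → ℝ} (hwa : ∀ i, 0 < wa i)
    (MV : (BondIdx D → Matrix (Fin N) (Fin N) ℂ) →L[ℂ] (BondIdx D → Matrix (Fin N) (Fin N) ℂ))
    (hMV : ∀ (X : BondIdx D → Matrix (Fin N) (Fin N) ℂ) (t : BondIdx D),
      MV X t = ∑ s, ((WithLp.ofLp ((EE D hc hwa - aE D wa) (WithLp.toLp 2 (Pi.single s 1))) t : ℝ) : ℂ) • X s)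
    (hMsym : ∀ a b, B (MV a) b = B a (MV b))
    (Q : (PBond (F.P K) 0 → Matrix (Fin N) (Fin N) ℂ) →L[ℂ] (BondIdx D → Matrix (Fin N) (Fin N) ℂ)),
    let η : ℝ := (((F.P K).L : ℝ)⁻¹) ^ (K - n)
    let C₂ : ℝ := (960 * ((((F.P K).d + 2) * (F.P K).L : ℕ) : ℝ) * ((F.P K).L : ℝ) / (12800 * ((((F.P K).d + 2) * (F.P K).L : ℕ) : ℝ) ^ 2 * ((F.P K).L : ℝ))⁻¹)
    let Qlin := (fderiv ℂ (chartLog η D : (PBond (F.P K) 0 → Matrix (Fin N) (Fin N) ℂ) → BondIdx D → Matrix (Fin N) (Fin N) ℂ) 0)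
    ∃ (Qt : (BondIdx D → Matrix (Fin N) (Fin N) ℂ) →L[ℂ] (PBond (F.P K) 0 → Matrix (Fin N) (Fin N) ℂ)) (Ht : (PBond (F.P K) 0 → Matrix (Fin N) (Fin N) ℂ) →L[ℂ] (BondIdx D → Matrix (Fin N) (Fin N) ℂ))
      (Dfun : (PBond (F.P K) 0 → Matrix (Fin N) (Fin N) ℂ) → (BondIdx D → Matrix (Fin N) (Fin N) ℂ))
      (Dt : (PBond (F.P K) 0 → Matrix (Fin N) (Fin N) ℂ) → ((BondIdx D → Matrix (Fin N) (Fin N) ℂ) →L[ℂ] (PBond (F.P K) 0 → Matrix (Fin N) (Fin N) ℂ))),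
      -- `Qt`, `Ht`
      (∀ X δ, BE (Qt X) δ = B X (Q δ)) ∧ (∀ Z X, BE Z (H X) = B (Ht Z) X) ∧
      -- the chart and its transposed derivative
      (∀ A' : PBond (F.P K) 0 → Matrix (Fin N) (Fin N) ℂ, (∀ b, w 1 b * ‖A' b‖ < ε) →
        (∀ ρ' : ℝ, 0 ≤ ρ' → (∀ b, w 1 b * ‖A' b‖ ≤ ρ') → ∀ i, ‖Dfun A' i‖ ≤ 4 * C₂ * ρ' ^ 2) ∧
        chartLog η D (A' - H (Dfun A')) - Qlin (A' - H (Dfun A')) = Dfun A' ∧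
        chartLog η D (A' - H (Dfun A')) = Qlin A') ∧
      ContDiffOn ℂ ω Dfun {Y : PBond (F.P K) 0 → Matrix (Fin N) (Fin N) ℂ | ∀ b, w 1 b * ‖Y b‖ < ε} ∧
      (∀ (A' : PBond (F.P K) 0 → Matrix (Fin N) (Fin N) ℂ) X δ, BE (Dt A' X) δ = B X (fderiv ℂ Dfun A' δ)) ∧
      -- ★ THE W-SLOT MODULO THREE NUMERIC LETTERS `q₀ θ₀ h₀` (+ the averaging letter `q` of `Q`), `O₁` DISCHARGED
      ∀ (wB' : BondIdx D → ℝ) (q₀ θ₀ h₀ ℓ q : ℝ), (∀ t, 0 ≤ wB' t) →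
        -- the output block weight in the multiplier band of k0-s1-w4's `h3132_of_adm22_T4`: `0 ≤ wB′(t) ≤ (L^{j(t)}η)⁻¹`
        (∀ t : BondIdx D, wB' t * (((F.P K).L : ℝ) ^ (t.1.1 : ℕ) * ((((F.P K).L : ℝ))⁻¹) ^ (K - n)) ≤ 1) →
        0 ≤ θ₀ → 0 ≤ h₀ → 1 + B₀ * (4 * C₂) * ε ≤ ℓ → 1 + B₁ * (4 * C₂) * ε ≤ ℓ → ℓ * ε ≤ 1 / 16 →
        -- the column letter of `Qt`
        (∀ (X : BondIdx D → Matrix (Fin N) (Fin N) ℂ) (s : ℝ), (∀ i, wB' i * ‖X i‖ ≤ s) → ∀ b, w 3 b * ‖Qt X b‖ ≤ q₀ * s) →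
        -- (73)ᵀ for `Dt`
        (∀ (A' : PBond (F.P K) 0 → Matrix (Fin N) (Fin N) ℂ) (r : ℝ), (∀ b, w 1 b * ‖A' b‖ ≤ r) →
          (∀ (b : PBond (F.P K) 0) (ν : Fin (F.P K).d), w 2 b * ((F.P K).L : ℝ) ^ (K - n) * ‖A' ⟨b.src.shift ν, b.dir⟩ - A' b‖ ≤ r) → r < ε →
          ∀ (X : BondIdx D → Matrix (Fin N) (Fin N) ℂ) (s : ℝ), (∀ i, wB' i * ‖X i‖ ≤ s) → ∀ b, w 3 b * ‖Dt A' X b‖ ≤ θ₀ * r * s) →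
        -- (46)ᵀ for `Ht`
        (∀ (Z : PBond (F.P K) 0 → Matrix (Fin N) (Fin N) ℂ) (s : ℝ), (∀ b, w 3 b * ‖Z b‖ ≤ s) → ∀ i, wB' i * ‖Ht Z i‖ ≤ h₀ * s) →
        -- the averaging letter of `Q`
        (∀ (A' : PBond (F.P K) 0 → Matrix (Fin N) (Fin N) ℂ) (r : ℝ), (∀ b, w 1 b * ‖A' b‖ ≤ r) → ∀ i, (1 : ℝ) * ‖Q A' i‖ ≤ q * r) →
        ∃ (e : Site (F.P K) 0 ≃ TSite (F.P K).d (fun _ => (F.P K).sitesPerDir 0)) (W : (PBond (F.P K) 0 → Matrix (Fin N) (Fin N) ℂ) → (PBond (F.P K) 0 → Matrix (Fin N) (Fin N) ℂ)),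
          (∀ (x : Site (F.P K) 0) (μ : Fin (F.P K).d), e (x.shift μ) = B9SectCLatticeCarrier.shift μ (e x)) ∧
          (∀ A' : PBond (F.P K) 0 → Matrix (Fin N) (Fin N) ℂ, (∀ b, w 1 b * ‖A' b‖ < ε) →
            (∀ (b : PBond (F.P K) 0) (ν : Fin (F.P K).d), w 2 b * ((F.P K).L : ℝ) ^ (K - n) * ‖A' ⟨b.src.shift ν, b.dir⟩ - A' b‖ < ε) →
            HasFDerivAt (fun A : PBond (F.P K) 0 → Matrix (Fin N) (Fin N) ℂ => 2⁻¹ * B (Dfun A) (((((((((F.P K).L : ℝ))⁻¹) ^ (K - n) : ℝ) : ℂ) ^ (F.P K).d) • MV) (Dfun A)) - B (Q A) (((((((((F.P K).L : ℝ))⁻¹) ^ (K - n) : ℝ) : ℂ) ^ (F.P K).d) • MV) (Dfun A))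
                + V0 (LatticeFieldCalculus.shiftEquiv (P := F.P K) (j := 0)) (fun _ _ => (1 : (Matrix (Fin N) (Fin N) ℂ)ˣ)) η (F.P K).d
                    (τ : Matrix (Fin N) (Fin N) ℂ →ₗ[ℂ] ℂ) (fun μ x => (A - H (Dfun A)) ⟨x, μ⟩))
              (BE (W A')) A') ∧
          DifferentiableOn ℂ W {Y : PBond (F.P K) 0 → Matrix (Fin N) (Fin N) ℂ | (∀ b, w 1 b * ‖Y b‖ < ε) ∧
            ∀ (b : PBond (F.P K) 0) (ν : Fin (F.P K).d), w 2 b * ((F.P K).L : ℝ) ^ (K - n) * ‖Y ⟨b.src.shift ν, b.dir⟩ - Y b‖ < ε} ∧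
          (∀ (Y : PBond (F.P K) 0 → Matrix (Fin N) (Fin N) ℂ) (r : ℝ), r < ε → (∀ b, w 1 b * ‖Y b‖ ≤ r) →
            (∀ (b : PBond (F.P K) 0) (ν : Fin (F.P K).d), w 2 b * ((F.P K).L : ℝ) ^ (K - n) * ‖Y ⟨b.src.shift ν, b.dir⟩ - Y b‖ ≤ r) →
            ∀ b, w 3 b * ‖W Y b‖ ≤
              (θ₀ * O₁ * (4 * C₂ * ε + q) + q₀ * O₁ * (4 * C₂)
                + (1 + θ₀ * ε * h₀) * ((((F.P K).d - 1 : ℕ) : ℝ) * (((F.P K).L : ℝ) ^ 2) ^ 3 * Mρ * (200 + 2 * ((F.P K).L : ℝ) ^ 2)) * ℓ ^ 2)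
                * r ^ 2)
    := by
  obtain ⟨Mh₀, R₀, O₁, hO₁, h31⟩ := h3132_of_adm22_T4 F
  refine ⟨Mh₀, max R₀ (2 * F.L), O₁, hO₁, ?_⟩
  intro n K hk1 hk' Mh R a' hMha hMh hR hsize D hDk hAdm _ _ w hw H hHinv B₀ hB₀ hHB B₁ hB₁ hHgrad ε hε h18 h2 τ ρ hρ hτ hτs hτ1 Mρ hMρ hρn
    BE hBE B hB hBsymm hc wa hwa MV hMV hMsym Q
  have hR₀ : R₀ ≤ R := le_trans (le_max_left _ _) hR
  have hR2L : 2 * (F.P K).L ≤ R := le_trans (le_max_right _ _) hR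
  have hMh1 : 1 ≤ Mh := by rw [hMha]; exact Nat.one_le_pow _ _ (F.P K).L_pos
  have hM1 : 1 ≤ F.L * Mh := le_trans hMh1 (Nat.le_mul_of_pos_left Mh (F.P K).L_pos)
  have hd : 4 ≤ (F.P K).d := le_of_eq (T4Family.P_d F K).symm
  -- the capstone at `MV := η^d • M_V` (B-symmetric by `smul_multiplier_symm`)
  have hMsym' : ∀ a b, B (((((((((F.P K).L : ℝ))⁻¹) ^ (K - n) : ℝ) : ℂ) ^ (F.P K).d) • MV) a) b = B a (((((((((F.P K).L : ℝ))⁻¹) ^ (K - n) : ℝ) : ℂ) ^ (F.P K).d) • MV) b) :=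
    fun a b => smul_multiplier_symm B MV hMsym _ a b
  obtain ⟨Qt, Ht, Dfun, Dt, hQt, hHt, hpt, hcd, hDt, main⟩ :=
    exists_sectF_W_atRecord_of_numericLetters_anyQ N (F.P K) hd (K - n) hR2L hM1 D hDk hAdm hw H hHinv hB₀ hHB hB₁ hHgrad hε h18 h2
      τ ρ hρ hτ hτs hτ1 hMρ hρn BE hBE B hB hBsymm _ hMsym' Q
  refine ⟨Qt, Ht, Dfun, Dt, hQt, hHt, hpt, hcd, hDt, ?_⟩
  intro wB' q₀ θ₀ h₀ ℓ q hwB0 hwB hθ₀ hh₀ hℓ₀ hℓ₁ hℓa hQt' h73t h46t hQ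
  -- k0-s1-w4's letter: the `h3132` binder at this family, this `M_V`, this `wB′`
  have h3132 : ∀ (X : BondIdx D → Matrix (Fin N) (Fin N) ℂ) (s : ℝ), (∀ i, (1 : ℝ) * ‖X i‖ ≤ s) →
      ∀ t, wB' t * ‖((((((((F.P K).L : ℝ))⁻¹) ^ (K - n) : ℝ) : ℂ) ^ (F.P K).d) • MV) X t‖ ≤ O₁ * s :=
    fun X s hX t => h31 n K hk1 hk' hMha hMh hR₀ hsize D hDk hAdm hc hwa MV hMV wB' hwB0 hwB X s hX t
  exact main wB' O₁ q₀ θ₀ h₀ ℓ q hO₁ hθ₀ hh₀ hℓ₀ hℓ₁ hℓa h3132 hQt' h73t h46t hQ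

-- A6 (non-vacuity of the parameter block): p614524 `K0Stub1SectFWSlotAtRecordInhabited.sectF_W_atRecord_parameters_inhabited` (same binders; its `MV` is p598821's
-- `exists_pairings_transposes_flatOps` operator, whose kernel formula is exactly `hMV` at `wa ≡ 1`).

end Summit.QuantumFields.YangMills.Theorems.K0Stub1SectFWSlotAtRecordO1

end
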